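import Summits.BirchSwinnertonDyer.BirchSwinnertonDyer.Theorems.PrintX8VSInputHondaSystemOmegaDivisibility
import Summits.BirchSwinnertonDyer.BirchSwinnertonDyer.Theorems.PrintX8VSInputHondaSystemDualCore
import HarnessLib

/-!
# `IsHondaSystem` from the PRIMAL Honda data: the four dual generation clauses (route `PrintX8VS` / `PrintX8`, support item
# `InputHondaSystem` = stmt-BirchSwinnertonDyer-20413, named fact `Sprung2012.thm22_exists_isHondaSystem`; file 15 of the local series)

HONEST FRAMING (desk `pub/bsd-wall/bsd-inputs`, seat `bsd-inputs-honda-p1`, D-0154 (2) INPUTS): THEOREMS ONLY — no definition, no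
named fact, no instance, no `sorry`; abstract over any `K`-field `E`; closes nothing by itself; BSD is not proved by any of this.

## What

`Sprung2012.IsHondaSystem κ ι W a_p g cneg c` (levels, the three trace relations, and the DUAL generation clauses: at level `0`
"`z ↦ z(c_{−1})` is injective with `p`-saturated image", at level `n ≥ 1` "`z ↦ (P_{n,c_n}(z), P_{n,c_{n−1}}(z)) mod ω_n` is injective
with `p`-torsion-free cokernel") FOLLOWS from the primal data: levels, relations, `a_p − 2 ∈ ℤ_pˣ`, a local lift `g` of the topological
generator, and generation in `ℤ[Γ]`-form with a multiplier `N` prime to `p`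
(`N·E(K_n·E) ⊆ ℤ[Γ·c_n] + E(K_{n−1}·E) + p·E(K_n·E)`, `N·E(E) ⊆ ℤ·c_{−1} + p·E(E)`). Ingredients: the divisibility engine and orbit
propagation (file `…DualCore`), and `ω_n`-divisibility read on the basis `(1+T)ʲ` (file `…OmegaDivisibility`).

References: [Sprung2012] F. Sprung, J. Number Theory 132 (2012), Thm. 2.2, Cor. 2.10, Def. 3.1, Lemmas 7.4–7.5; [Kobayashi2003]
S. Kobayashi, Invent. Math. 152 (2003), Prop. 8.12.
-/

set_option autoImplicit false
-- the Theorems namespace of this sub repeats the summit name by design (D-0017 nested layout)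
set_option linter.dupNamespace false

noncomputable section

open scoped Classical
open Finset

universe u

namespace Summit.BirchSwinnertonDyer.BirchSwinnertonDyer.Theorems

namespace SprungHonda

open Literature.NumberTheory.EllipticCurves Literature.NumberTheory.GaloisRepresentations
  Literature.NumberTheory.EllipticCurves.ZpExtension Literature.NumberTheory.EllipticCurves.Kobayashi2003
  Literature.NumberTheory.EllipticCurves.Sprung2012 Literature.NumberTheory.EllipticCurves.Sprung2017

variable {K : Type u} [Field K] {p : ℕ} [hp : Fact p.Prime] (κ : ZpExtension K p)
variable {E : Type u} [Field E] [Algebra K E] (ι : AlgebraicClosure K →ₐ[K] AlgebraicClosure E) (W : WeierstrassCurve K)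

/-- **`IsHondaSystem` from the primal Honda data.** [cite: Sprung2012, Thm. 2.2 (p. 1487) and Cor. 2.10 (p. 1489)]
[cite: Kobayashi2003, Prop. 8.12] -/
theorem isHondaSystem_of_primal {ap : ℤ} (hap : IsUnit ((ap - 2 : ℤ) : ℤ_[p])) {g : Field.absoluteGaloisGroup E}
    (hg : κ.IsTopGenerator (resGalOfEmb ι g)) {N : ℕ} (hN : N.Coprime p) {cneg : localPoints W E} {c : ℕ → localPoints W E}
    (hcneg : cneg ∈ localLayerPointsOfEmb κ ι W 0) (hc : ∀ n, c n ∈ localLayerPointsOfEmb κ ι W n)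
    (hR0 : c 0 = (ap - 2) • cneg)
    (hR1 : localTraceOfEmb κ ι W 0 1 (c 1) = ap • c 0 - ((p : ℤ) - 1) • cneg)
    (hRn : ∀ n : ℕ, 1 ≤ n → localTraceOfEmb κ ι W n (n + 1) (c (n + 1)) = ap • c n - c (n - 1))
    (hGEN : ∀ m : ℕ, 1 ≤ m → ∀ P ∈ localLayerPointsOfEmb κ ι W m,
      ∃ B ∈ AddSubgroup.closure (Set.range fun σ : Field.absoluteGaloisGroup E ↦ σ • c m),
        ∃ P' ∈ localLayerPointsOfEmb κ ι W (m - 1), ∃ R ∈ localLayerPointsOfEmb κ ι W m, N • P = B + P' + p • R)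
    (hGEN0 : ∀ P ∈ localLayerPointsOfEmb κ ι W 0,
      ∃ u : ℤ, ∃ R ∈ localLayerPointsOfEmb κ ι W 0, N • P = u • cneg + p • R) :
    IsHondaSystem κ ι W ap g cneg c := by
  -- the level-`0` engine: divisibility on `Γ·c_0 = {c_0}` and `cneg` suffices
  have hc0fix : ∀ σ : Field.absoluteGaloisGroup E, σ • c 0 = c 0 := (mem_localLayerPointsOfEmb_zero_iff κ ι W _).mp (hc 0)
  have core0 : ∀ (K₀ : ℕ) (z : localLayerPointsOfEmb κ ι W 0 →+ ℤ_[p]),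
      (p : ℤ_[p]) ^ K₀ ∣ evalOn W (localLayerPointsOfEmb κ ι W 0) z cneg →
      ∀ P ∈ localLayerPointsOfEmb κ ι W 0, (p : ℤ_[p]) ^ K₀ ∣ evalOn W (localLayerPointsOfEmb κ ι W 0) z P := by
    intro K₀ z hneg
    refine pow_dvd_evalOn_of_generation κ ι W hN hcneg hc hGEN hGEN0 0 K₀ z ?_ hneg
    intro m hm σ
    obtain rfl : m = 0 := Nat.le_zero.mp hm
    rw [hc0fix, hR0, evalOn_zsmul_mem W _ z hcneg]
    exact hneg.mul_left _
  -- the level-`n` engine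
  have coren : ∀ {n : ℕ}, 1 ≤ n → ∀ (K₀ : ℕ) (z : localLayerPointsOfEmb κ ι W n →+ ℤ_[p]),
      (∀ j < p ^ n, (p : ℤ_[p]) ^ K₀ ∣ evalOn W (localLayerPointsOfEmb κ ι W n) z (g ^ j • c n)) →
      (∀ j < p ^ n, (p : ℤ_[p]) ^ K₀ ∣ evalOn W (localLayerPointsOfEmb κ ι W n) z (g ^ j • c (n - 1))) →
      ∀ P ∈ localLayerPointsOfEmb κ ι W n, (p : ℤ_[p]) ^ K₀ ∣ evalOn W (localLayerPointsOfEmb κ ι W n) z P := by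
    intro n hn K₀ z hzn hzn1
    obtain ⟨horb, hneg⟩ := pow_dvd_evalOn_orbit_of_relations κ ι W hg hap hcneg hc hR0 hRn hn K₀ z hzn hzn1
    exact pow_dvd_evalOn_of_generation κ ι W hN hcneg hc hGEN hGEN0 n K₀ z horb hneg
  refine ⟨hcneg, hc, hR0, hR1, hRn, ?_, ?_, ?_, ?_⟩
  · -- level `0`, injectivity
    intro z hz
    ext ⟨P, hP⟩
    rw [AddMonoidHom.zero_apply]
    refine padicInt_eq_zero_of_forall_pow_dvd fun K₀ ↦ ?_
    have := core0 K₀ z (by rw [hz]; exact dvd_zero _) P hP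
    rwa [evalOn_of_mem W _ z hP] at this
  · -- level `0`, `p`-saturation
    rintro a ⟨z, hz⟩
    have hdiv : ∀ P : localLayerPointsOfEmb κ ι W 0, (p : ℤ_[p]) ∣ z P := by
      rintro ⟨P, hP⟩
      have := core0 1 z (by rw [hz, pow_one]; exact dvd_mul_right _ _) P hP
      rwa [pow_one, evalOn_of_mem W _ z hP] at this
    obtain ⟨y, rfl⟩ := exists_eq_smul_of_forall_dvd z hdiv
    refine ⟨y, ?_⟩
    have hp0 : (p : ℤ_[p]) ≠ 0 := by exact_mod_cast hp.out.ne_zero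
    apply mul_left_cancel₀ hp0
    rw [← hz, evalOn_of_mem W _ _ hcneg, evalOn_of_mem W _ _ hcneg, AddMonoidHom.smul_apply, smul_eq_mul]
  · -- level `n ≥ 1`, injectivity
    intro n hn z h1 h2
    rw [pairingSum_def] at h1 h2
    have e1 := forall_eq_zero_of_omega_dvd_sum h1
    have e2 := forall_eq_zero_of_omega_dvd_sum h2
    ext ⟨P, hP⟩
    rw [AddMonoidHom.zero_apply]
    refine padicInt_eq_zero_of_forall_pow_dvd fun K₀ ↦ ?_
    have := coren hn K₀ z (fun j hj ↦ by rw [e1 j hj]; exact dvd_zero _) (fun j hj ↦ by rw [e2 j hj]; exact dvd_zero _) P hP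
    rwa [evalOn_of_mem W _ z hP] at this
  · -- level `n ≥ 1`, `p`-torsion-free cokernel
    rintro n hn a b ⟨z, ha, hb⟩
    rw [pairingSum_def] at ha hb
    have d1 := forall_dvd_of_omega_dvd_C_mul_sub_sum ha
    have d2 := forall_dvd_of_omega_dvd_C_mul_sub_sum hb
    have hdiv : ∀ P : localLayerPointsOfEmb κ ι W n, (p : ℤ_[p]) ∣ z P := by
      rintro ⟨P, hP⟩
      have := coren hn 1 z (fun j hj ↦ by rw [pow_one]; exact d1 j hj) (fun j hj ↦ by rw [pow_one]; exact d2 j hj) P hP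
      rwa [pow_one, evalOn_of_mem W _ z hP] at this
    obtain ⟨y, rfl⟩ := exists_eq_smul_of_forall_dvd z hdiv
    refine ⟨y, ?_, ?_⟩
    · refine omega_dvd_of_omega_dvd_C_mul ?_
      rw [mul_sub, ← pairingSum_smul, pairingSum_def]
      exact ha
    · refine omega_dvd_of_omega_dvd_C_mul ?_
      rw [mul_sub, ← pairingSum_smul, pairingSum_def]
      exact hb

end SprungHonda

end Summit.BirchSwinnertonDyer.BirchSwinnertonDyer.Theorems

end
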